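import Summits.KontsevichZagierPeriods.KontsevichZagierPeriods.Theorems.VietaFibreKernelFormCut
import Summits.KontsevichZagierPeriods.KontsevichZagierPeriods.Theorems.VietaFibreKernelFormThinCubeRep
import Summits.KontsevichZagierPeriods.KontsevichZagierPeriods.Theorems.VietaFibreKernelFormAveraging
import Summits.KontsevichZagierPeriods.KontsevichZagierPeriods.Theorems.XMapPeriodTransfer.Negative.ValueSide
import HarnessLib

/-!
# Crux `KernelForm` (stmt-KontsevichZagierPeriods-10447), line `Sketch`: the near-one normal form of `Cancellation`

The cut of the crux (Conjecture 1 of Kontsevich–Zagier in kernel form, for the calculus of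
`KZCalculus.lean`) is `KernelForm ↔ WeakKernel ∧ Cancellation`, and the registered conjecture-grade
stub `stub_unitPlusSmallCancellation` is `Cancellation` in thin-canceller form.  Here is the
**near-one normal form** of the same statement, parallel to the closedness form of the crux
(`kernelForm_iff_supClosed`, file `…Averaging.lean`):

* `cancellation_iff_nearOne` — for every `0 < θ < 1`,
  `Cancellation ↔ ∀ W V, W = [[0,1]^m, w], V = [[0,1]^k, v], sup |v| ≤ θ →
     [W] + [V] * [W] ∈ relations → [W] ∈ relations`,
  i.e. **the geometric half of Conjecture 1 says exactly that one may divide by `1 + v(x)` for every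
  `ℚ`-semialgebraic `v` on a unit cube in FRESH variables with `‖v‖∞ ≤ θ`**.  In the formal period
  ring `P = FormalRep ⧸ relations` these `1 + [V]` are precisely the elements that the geometric
  series `∑ (-[V])^n` would invert if `P` were complete for the sup norm of cube integrands; the
  stub asks only that they be non-zero-divisors.

`→`: `[U] + [V]` has value `≥ 1 − θ > 0` and `([U] + [V]) * [W] ≡ [W] + [V] * [W]`.
`←`: by the canceller normal form (`cancellation_iff_thinCancellation`), the reduction to unit-cube
representations (`thinCancellation_iff_cubeRep`) and the averaging normal form
(`exists_cubeRep_integrand_sub_eval_le`), a thin canceller `[K, κ]` of value `< θ/2` is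
move-equivalent to a cube representation `V` with `sup |v| ≤ θ`.

References: M. Kontsevich, D. Zagier, *Periods* (2001), §1.2, §4.1.
-/

noncomputable section

open MeasureTheory Set
open Literature.NumberTheory.Transcendental

namespace Summit.KontsevichZagierPeriods.KernelForm.LocaliseAtValuePrime

/-- The value of a unit-cube representation with `sup |integrand| ≤ θ` is at most `θ` in absolute
value. [folklore] -/
theorem abs_value_le_of_cube {k : ℕ} (V : KZ.IntegralRep k) (hVd : V.domain = KZ.cube k) {θ : ℝ}
    (hV : ∀ y ∈ V.domain, |V.integrand y| ≤ θ) : |V.value| ≤ θ := by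
  rw [KZ.IntegralRep.value]
  calc |∫ y in V.domain, V.integrand y| ≤ ∫ y in V.domain, |V.integrand y| :=
        abs_integral_le_integral_abs
    _ ≤ ∫ _ in V.domain, θ := by
        refine setIntegral_mono_on V.integrableOn.abs (integrableOn_const (by
          rw [hVd]; simp)) (KZ.IntegralRep.measurableSet_domain_holds V) fun y hy => hV y hy
    _ = θ := by rw [setIntegral_const, hVd, KZ.volume_real_cube, smul_eq_mul, one_mul]

/-- **Near-one elements are cancelled by `Cancellation`**: if `Cancellation` holds, `V` is a unit-cube
representation with `sup |v| ≤ θ < 1` and `[W] + [V] * [W] ∈ relations`, then `[W] ∈ relations`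
(canceller `[U] + [V]`, of value `≥ 1 − θ > 0`). [folklore] -/
theorem nearOne_of_cancellation {θ : ℝ} (hθ1 : θ < 1)
    (hC : ∀ c s : KZ.FormalRep, KZ.eval s ≠ 0 → s * c ∈ KZ.relations → c ∈ KZ.relations)
    {m k : ℕ} (W : KZ.IntegralRep m) (V : KZ.IntegralRep k) (hVd : V.domain = KZ.cube k)
    (hV : ∀ y ∈ V.domain, |V.integrand y| ≤ θ) (h : KZ.of W + KZ.of V * KZ.of W ∈ KZ.relations) :
    KZ.of W ∈ KZ.relations := by
  obtain ⟨U, hUd, hUi⟩ := KZ.exists_oneRep (KZ.isSemialgebraic_cube (n := k)) (by simp [KZ.volume_cube])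
  have hUv : U.value = 1 := by
    rw [KZ.IntegralRep.value_eq_volume_real U (fun x _ => by rw [hUi]), hUd, KZ.volume_real_cube]
  refine hC (KZ.of W) (KZ.of U + KZ.of V) ?_ ?_
  · rw [map_add, KZ.eval_of, KZ.eval_of, hUv]
    have := (abs_le.mp (abs_value_le_of_cube V hVd hV)).1
    linarith
  · have hU1 : KZ.of U * KZ.of W - KZ.of W ∈ KZ.relations := by
      have e : KZ.of U * KZ.of W - KZ.of W =
          (KZ.of U * KZ.of W - KZ.of W * KZ.of U) + (KZ.of W * KZ.of U - KZ.of W) := by abel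
      rw [e]
      exact KZ.relations.add_mem (KZ.mul_sub_mul_comm_mem_relations _ _)
        (stub_cubeMul k U (KZ.of W) hUd hUi)
    have e : (KZ.of U + KZ.of V) * KZ.of W =
        (KZ.of U * KZ.of W - KZ.of W) + (KZ.of W + KZ.of V * KZ.of W) := by
      rw [add_mul]; abel
    rw [e]
    exact KZ.relations.add_mem hU1 h

/-- **The near-one normal form of the geometric half.** For every `0 < θ < 1`:
`Cancellation ↔` "for all unit-cube representations `W`, `V` with `sup |v| ≤ θ`,
`[W] + [V] * [W] ∈ relations → [W] ∈ relations`" — one may divide by `1 + v(x)`, `v` a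
`ℚ`-semialgebraic function of fresh variables with `‖v‖∞ ≤ θ`. [folklore] -/
theorem cancellation_iff_nearOne :
    ∀ θ : ℝ, 0 < θ → θ < 1 →
      ((∀ c s : KZ.FormalRep, KZ.eval s ≠ 0 → s * c ∈ KZ.relations → c ∈ KZ.relations) ↔
        ∀ (m k : ℕ) (W : KZ.IntegralRep m) (V : KZ.IntegralRep k), W.domain = KZ.cube m →
          V.domain = KZ.cube k → (∀ y ∈ V.domain, |V.integrand y| ≤ θ) →
          KZ.of W + KZ.of V * KZ.of W ∈ KZ.relations → KZ.of W ∈ KZ.relations) := by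
  intro θ hθ0 hθ1
  constructor
  · intro hC m k W V _ hVd hV h
    exact nearOne_of_cancellation hθ1 hC W V hVd hV h
  · intro hN
    rw [cancellation_iff_thinCancellation, thinCancellation_iff_cubeRep]
    intro m W hWd hthin
    -- a thin canceller of value `< θ/2` …
    obtain ⟨k, K, κ, hκ, -, -, hKi, hKv, hWK⟩ := hthin (θ / 2) (by positivity)
    -- … is move-equivalent to a cube representation `V` with `sup |v| ≤ θ`
    obtain ⟨k', hk'⟩ := exists_cubeRep_integrand_sub_eval_le (KZ.of K)
    obtain ⟨V, hVd, hVb, hKV⟩ := hk' (θ / 2) (by positivity)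
    have hK0 : 0 ≤ KZ.eval (KZ.of K) := by
      rw [KZ.eval_of]; exact value_nonneg_of_integrand_eq_const K hκ hKi
    refine hN m k' W V hWd hVd (fun y hy => ?_) ?_
    · have h1 := abs_le.mp (hVb y hy)
      rw [abs_le]
      constructor <;> linarith [h1.1, h1.2]
    · -- `[W] + [V][W] = ([W] + [K][W]) − ([K] − [V]) [W]`
      have h2 : (KZ.of K - KZ.of V) * KZ.of W ∈ KZ.relations :=
        KZ.mul_mem_relations_right_holds _ (KZ.of W) hKV
      have e : KZ.of W + KZ.of V * KZ.of W =
          (KZ.of W + KZ.of K * KZ.of W) - (KZ.of K - KZ.of V) * KZ.of W := by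
        rw [sub_mul]; abel
      rw [e]
      exact KZ.relations.sub_mem hWK h2


/-! ### `θ < 1` is sharp -/

/-- **`θ < 1` is sharp in `cancellation_iff_nearOne`**: at `θ = 1` the near-one statement FAILS
unconditionally — with `V = [[0,1]^0, −1]` (`sup |v| = 1`) one has `[W] + [V] * [W] ≡ 0` for every
`W`, while the unit `W = [[0,1]^0, 1]` (value `1`) is not a relation.  So the hypothesis `θ < 1`
(positivity of the value of the canceller `1 + [V]`) is load-bearing, not a convenience. [folklore] -/
theorem not_nearOne_one :
    ¬ ∀ (m k : ℕ) (W : KZ.IntegralRep m) (V : KZ.IntegralRep k), W.domain = KZ.cube m →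
        V.domain = KZ.cube k → (∀ y ∈ V.domain, |V.integrand y| ≤ 1) →
        KZ.of W + KZ.of V * KZ.of W ∈ KZ.relations → KZ.of W ∈ KZ.relations := by
  intro h
  obtain ⟨U, hUd, hUi⟩ := KZ.exists_oneRep (KZ.isSemialgebraic_cube (n := 0)) (by simp)
  have hUv : U.value = 1 := by
    rw [KZ.IntegralRep.value_eq_volume_real U (fun x _ => by rw [hUi]), hUd, KZ.volume_real_cube]
  have hV : ∀ y ∈ U.neg.domain, |U.neg.integrand y| ≤ 1 := fun y _ => by simp [hUi]
  have h1 : KZ.of U + KZ.of U.neg * KZ.of U ∈ KZ.relations := by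
    -- `[U.neg] * [U] ≡ −[U] * [U] ≡ −[U]`
    have e1 : (KZ.of U + KZ.of U.neg) * KZ.of U ∈ KZ.relations :=
      KZ.mul_mem_relations_right_holds _ (KZ.of U)
        (Summit.KontsevichZagierPeriods.IsogenyCertificates.XMapPeriodTransferValue.of_add_of_neg_mem_relations U)
    have e2 : KZ.of U * KZ.of U - KZ.of U ∈ KZ.relations := stub_cubeMul 0 U (KZ.of U) hUd hUi
    have e : KZ.of U + KZ.of U.neg * KZ.of U =
        (KZ.of U + KZ.of U.neg) * KZ.of U - (KZ.of U * KZ.of U - KZ.of U) := by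
      rw [add_mul]; abel
    rw [e]
    exact KZ.relations.sub_mem e1 e2
  have h2 := h 0 0 U U.neg hUd (by rw [KZ.IntegralRep.domain_neg, hUd]) hV h1
  have h3 := KZ.eval_eq_zero_of_mem_relations h2
  rw [KZ.eval_of, hUv] at h3
  exact one_ne_zero h3

end Summit.KontsevichZagierPeriods.KernelForm.LocaliseAtValuePrime
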